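import Literature.Topology.CoveringSpaces.UniversalCoverLift
import Literature.AlgebraicTopology.FundamentalGroup.FiniteCover
import Mathlib.GroupTheory.FreeGroup.Basic
import Mathlib.Topology.Bases
import HarnessLib

/-!
# The fundamental group of a second countable space is countable; the universal cover is second
# countable

Topic `Literature/Topology/CoveringSpaces` (PROOF-ONLY; no definitions).  J. M. Lee, *Introduction
to Topological Manifolds*, 2nd ed. (2011), Thm. 7.21 «The fundamental group of a topological manifold
is countable» with its proof (a countable cover by path connected open sets in which loops are
null-homotopic in the whole space, a countable set of points meeting every path component of every
pairwise intersection, and the Lebesgue-number subdivision of a loop; cf. Hatcher, *Algebraic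
Topology* (2002), Lemma 1.15 / proof of Thm. 1.20), and its corollary that the universal covering
space of a second countable manifold is second countable (countable fibres `≅ π₁`).  The compact /
finite-cover form is the tree's `fundamentalGroup_fg_of_finite_cover` (`FiniteCover.lean`), whose
induction along a Lebesgue partition we follow, with two changes: the cover is COUNTABLE and consists
of GOOD sets (`UniversalCover.goodSets`: two paths in a member with the same endpoints are homotopic
in `X`), and the meeting points are taken in a countable DENSE set, one in the path component of the
current subdivision point (so no hypothesis on unions of two members is needed).

* (private) `countable_subgroupClosure` — the subgroup generated by a countable set is countable;
* `countable_fundamentalGroup_of_cover` — `π₁(X, x₀)` is countable when `X` (locally path connected)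
  is covered by countably many good sets and has a countable dense subset;
* `countable_fundamentalGroup` — **Lee Thm. 7.21**: `π₁(X, x₀)` is countable for `X` second
  countable and strongly locally contractible (e.g. a second countable topological manifold);
* `secondCountableTopology_of_isCoveringMap` — the total space of a covering map with countable
  fibres over a second countable base is second countable;
* `UniversalCover.countable_fibre`, `UniversalCover.secondCountableTopology` — the universal cover
  `X̃ → X` (Hatcher's construction, `UniversalCover X x₀`) of a path connected, second countable,
  strongly locally contractible space has countable fibres and is second countable.

Consumer: Tier 2 of the abc-iut cell's uniformization programme «UNIF» (the named fact
`RiemannSurface.SimplyConnectedUniformization` binds `[SecondCountableTopology S]` and is applied to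
the universal cover of a second countable Riemann surface).  Classical; nothing here bears on
[IUTchIII] Cor. 3.12.

## References
* [Lee2011TopologicalManifolds] J. M. Lee, Introduction to Topological Manifolds, 2nd ed., GTM 202
  (2011), Thm. 7.21 and its proof; Cor. 11.x (countable fibres of the universal cover).
* [HatcherAT2002] A. Hatcher, Algebraic Topology (2002), Lemma 1.15, proof of Thm. 1.20, §1.3
  pp. 63–65.
-/

noncomputable section

open Set Function Filter Topology TopologicalSpace unitInterval

namespace Literature.Topology.CoveringSpaces

universe u

/-! ### Countably generated subgroups are countable -/

/-- The subgroup generated by a countable subset of a group is countable (it is the image of the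
free group on the subset, a countable type). [folklore] -/
private theorem countable_subgroupClosure {G : Type*} [Group G] {s : Set G} (hs : s.Countable) :
    Countable (Subgroup.closure s) := by
  haveI : Countable s := hs.to_subtype
  haveI : Countable (FreeGroup s) := by
    have hsurj : Surjective (FreeGroup.mk : List (s × Bool) → FreeGroup s) := Quot.mk_surjective
    exact hsurj.countable
  have hrange : ((FreeGroup.lift ((↑) : s → G)).range : Subgroup G) = Subgroup.closure s := by
    rw [FreeGroup.range_lift_eq_closure, Subtype.range_coe]
  have hc : ((Subgroup.closure s : Subgroup G) : Set G).Countable := by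
    rw [← hrange, MonoidHom.coe_range]
    exact countable_range _
  exact hc.to_subtype

/-- A group generated by a countable subset is countable. [folklore] -/
private theorem countable_of_subgroupClosure_eq_top {G : Type*} [Group G] {s : Set G} (hs : s.Countable)
    (htop : Subgroup.closure s = ⊤) : Countable G := by
  haveI := countable_subgroupClosure hs
  have e : (Subgroup.closure s) ≃ G :=
    (MulEquiv.subgroupCongr htop).toEquiv.trans Subgroup.topEquiv.toEquiv
  exact Countable.of_equiv _ e

/-! ### Countability of the fundamental group from a countable good cover -/

section Cover

variable {X : Type u} [TopologicalSpace X]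

open UniversalCover in
/-- **Countability of `π₁` from a countable good cover** (Lee 2011, proof of Thm. 7.21; Hatcher,
proof of Thm. 1.20): let `X` be locally path connected with a countable dense subset `D`, covered by
countably many GOOD open sets `V i` (open, path connected, loops in `V i` null-homotopic in `X`).  Then
`π₁(X, x₀)` is countable: it is generated by the countably many classes
`[g i · a · b · (g j)⁻¹]` (`a : v i ⟶ d` in `V i`, `b : d ⟶ v j` in `V j`, `d ∈ D ∩ V i ∩ V j`) and
`[g i · e i]`, by Lebesgue subdivision of a loop and induction along the partition — at a subdivision
point `γ s' ∈ V i ∩ V j` one passes through a point of `D` in the path component of `γ s'` in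
`V i ∩ V j`. [cite: Lee2011TopologicalManifolds, Thm. 7.21 (proof)] -/
theorem countable_fundamentalGroup_of_cover [LocallyPathConnectedSpace X] {ι : Type*} [Countable ι]
    {D : Set X} (hDc : D.Countable) (hDd : Dense D) (V : ι → Set X)
    (hV : ∀ i, V i ∈ goodSets X) (hcov : ⋃ i, V i = univ) (x₀ : X) :
    Countable (FundamentalGroup X x₀) := by
  classical
  have hVo : ∀ i, IsOpen (V i) := fun i => isOpen_of_mem_goodSets (hV i)
  have hVc : ∀ i, IsPathConnected (V i) := fun i => isPathConnected_of_mem_goodSets (hV i)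
  -- (0) cancellation `γ⁻¹ · (γ · δ) = δ` for path classes
  have cancel : ∀ {a b c : X} (γ : Path.Homotopic.Quotient a b) (δ : Path.Homotopic.Quotient b c),
      γ.symm.trans (γ.trans δ) = δ := fun γ δ => by
    rw [← Path.Homotopic.Quotient.trans_assoc, Path.Homotopic.Quotient.symm_trans,
      Path.Homotopic.Quotient.refl_trans]
  have cancel' : ∀ {a b c : X} (γ : Path.Homotopic.Quotient a b) (δ : Path.Homotopic.Quotient a c),
      γ.trans (γ.symm.trans δ) = δ := fun γ δ => by
    rw [← Path.Homotopic.Quotient.trans_assoc, Path.Homotopic.Quotient.trans_symm,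
      Path.Homotopic.Quotient.refl_trans]
  -- two paths inside a good set with the same endpoints have the same class
  have good : ∀ i {y z : X} (η η' : Path y z), range η ⊆ V i → range η' ⊆ V i →
      Path.Homotopic.Quotient.mk η = Path.Homotopic.Quotient.mk η' := by
    intro i y z η η' hη hη'
    exact Path.Homotopic.Quotient.eq.2 (homotopic_of_mem_goodSets (hV i) η η'
      (fun t => hη (mem_range_self t)) (fun t => hη' (mem_range_self t)))
  -- (1) chosen points and chosen paths inside the pieces
  choose v hv using fun i => (hVc i).nonempty
  have pin : ∀ i, ∀ a ∈ V i, ∀ b ∈ V i, ∃ p : Path a b, range p ⊆ V i := fun i a ha b hb =>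
    ⟨((hVc i).joinedIn a ha b hb).somePath,
      range_subset_iff.2 ((hVc i).joinedIn a ha b hb).somePath_mem⟩
  choose pth hpth using pin
  haveI : Countable D := hDc.to_subtype
  -- (2) the countably many generators
  let α : ι × ι × D → FundamentalGroup X x₀ := fun p =>
    if h : ((p.2.2 : X) ∈ V p.1 ∧ (p.2.2 : X) ∈ V p.2.1) ∧ Joined x₀ (v p.1) ∧ Joined x₀ (v p.2.1) then
      FundamentalGroup.fromPath (Path.Homotopic.Quotient.mk
        ((h.2.1.somePath.trans ((pth p.1 (v p.1) (hv p.1) p.2.2 h.1.1).trans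
          (pth p.2.1 p.2.2 h.1.2 (v p.2.1) (hv p.2.1)))).trans h.2.2.somePath.symm))
    else 1
  let β : ι → FundamentalGroup X x₀ := fun i =>
    if h : x₀ ∈ V i then
      FundamentalGroup.fromPath (Path.Homotopic.Quotient.mk
        ((Joined.somePath ⟨(pth i (v i) (hv i) x₀ h).symm⟩).trans (pth i (v i) (hv i) x₀ h)))
    else 1
  let H : Subgroup (FundamentalGroup X x₀) := Subgroup.closure (range α ∪ range β)
  have hαH : ∀ p, α p ∈ H := fun p => Subgroup.subset_closure (Or.inl ⟨p, rfl⟩)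
  have hβH : ∀ i, β i ∈ H := fun i => Subgroup.subset_closure (Or.inr ⟨i, rfl⟩)
  -- (3) it suffices that the class of every loop lies in `H`
  suffices key : ∀ γ : Path x₀ x₀, FundamentalGroup.fromPath (Path.Homotopic.Quotient.mk γ) ∈ H by
    refine countable_of_subgroupClosure_eq_top ((countable_range α).union (countable_range β)) ?_
    rw [eq_top_iff]
    rintro g -
    obtain ⟨γ, hγ⟩ := Path.Homotopic.Quotient.mk_surjective (FundamentalGroup.toPath g)
    rw [show g = FundamentalGroup.fromPath (Path.Homotopic.Quotient.mk γ) from hγ.symm]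
    exact key γ
  intro γ
  have hx : x₀ = γ 0 := γ.source.symm
  have e01 : (γ.subpath 0 1).cast hx γ.target.symm = γ := by
    ext u
    rw [Path.cast_coe, Path.subpath_zero_one, Path.cast_coe]
  have e00 : (γ.subpath 0 0).cast hx hx = Path.refl x₀ := by
    ext u
    rw [Path.cast_coe, Path.subpath_self, Path.refl_apply, Path.refl_apply, ← hx]
  -- (4) Lebesgue partition of the loop subordinate to the cover
  obtain ⟨t, ht0, htm, ⟨N, hN⟩, hsub⟩ :=
    exists_monotone_Icc_subset_open_cover_unitInterval (c := fun i => γ ⁻¹' V i)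
      (fun i => (hVo i).preimage γ.continuous)
      (by
        intro s _
        have hs : γ s ∈ ⋃ i, V i := by rw [hcov]; exact mem_univ _
        simpa only [mem_iUnion, mem_preimage] using hs)
  choose idx hidx using hsub
  -- (5) the inductive claim
  let P : I → ι → Prop := fun s i => ∀ (y : X) (hy : γ s = y), y ∈ V i →
    ∀ (J : Joined x₀ (v i)) (h : Path (v i) y), range h ⊆ V i →
      ∃ w ∈ H, Path.Homotopic.Quotient.mk ((γ.subpath 0 s).cast hx hy.symm) =
        (FundamentalGroup.toPath w).trans
          ((Path.Homotopic.Quotient.mk J.somePath).trans (Path.Homotopic.Quotient.mk h))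
  -- identification of `β i`
  have hβ : ∀ i (hi : x₀ ∈ V i) (J : Joined x₀ (v i)) (h : Path (v i) x₀), range h ⊆ V i →
      β i = FundamentalGroup.fromPath ((Path.Homotopic.Quotient.mk J.somePath).trans
        (Path.Homotopic.Quotient.mk h)) := by
    intro i hi J h hh
    have e : Path.Homotopic.Quotient.mk (pth i (v i) (hv i) x₀ hi) =
        Path.Homotopic.Quotient.mk h := good i _ _ (hpth _ _ _ _ _) hh
    have hβi : β i = FundamentalGroup.fromPath (Path.Homotopic.Quotient.mk
        (J.somePath.trans (pth i (v i) (hv i) x₀ hi))) := dif_pos hi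
    rw [hβi, Path.Homotopic.Quotient.mk_trans, e]
  -- base case
  have base : ∀ i, P 0 i := by
    intro i y hy hyi J h hh
    obtain rfl : x₀ = y := γ.source.symm.trans hy
    refine ⟨(β i)⁻¹, H.inv_mem (hβH i), ?_⟩
    rw [e00, hβ i hyi J h hh, Path.Homotopic.Quotient.mk_refl, FundamentalGroup.inv_def]
    exact (Path.Homotopic.Quotient.symm_trans _).symm
  -- induction step
  have step : ∀ (s s' : I) (i j : ι), s ≤ s' → Icc s s' ⊆ γ ⁻¹' V i → P s i → P s' j := by
    intro s s' i j hss' hI hP y hy hyj J h hh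
    subst hy
    have hpi : γ s' ∈ V i := hI ⟨hss', le_rfl⟩
    have hsi : γ s ∈ V i := hI ⟨le_rfl, hss'⟩
    -- a point of `D` in the path component of `γ s'` in `V i ∩ V j`, and a path to it there
    have hCo : IsOpen (pathComponentIn (V i ∩ V j) (γ s')) :=
      ((hVo i).inter (hVo j)).pathComponentIn _
    obtain ⟨d, hdD, hdC⟩ := hDd.exists_mem_open hCo
      ⟨γ s', mem_pathComponentIn_self ⟨hpi, hyj⟩⟩
    have hdij : d ∈ V i ∩ V j := pathComponentIn_subset hdC
    have hjd : JoinedIn (V i ∩ V j) (γ s') d := by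
      have := (isPathConnected_pathComponentIn (F := V i ∩ V j) ⟨hpi, hyj⟩).joinedIn
        (γ s') (mem_pathComponentIn_self ⟨hpi, hyj⟩) d hdC
      exact this.mono pathComponentIn_subset
    let dp : Path (γ s') d := hjd.somePath
    have hdp : range dp ⊆ V i ∩ V j := range_subset_iff.2 hjd.somePath_mem
    -- auxiliary paths inside `V i`, `V j`
    let h' : Path (v i) (γ s) := pth i (v i) (hv i) (γ s) hsi
    have hh' : range h' ⊆ V i := hpth _ _ _ _ _
    let seg : Path (γ s) (γ s') := γ.subpath s s'
    have hseg : range seg ⊆ V i := by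
      rw [Path.range_subpath_of_le γ s s' hss']
      exact image_subset_iff.2 hI
    let d' : D := ⟨d, hdD⟩
    let a : Path (v i) d := pth i (v i) (hv i) d hdij.1
    let b : Path d (v j) := pth j d hdij.2 (v j) (hv j)
    have Ji : Joined x₀ (v i) := ⟨((γ.subpath 0 s').cast hx rfl).trans ((h'.trans seg).symm)⟩
    -- induction hypothesis for the prefix up to `s`
    obtain ⟨w₁, hw₁, E1⟩ := hP (γ s) rfl hsi Ji h' hh'
    -- inside `V i`: `h' · seg ≃ a · dp⁻¹`; inside `V j`: `h ≃ b⁻¹ · dp⁻¹`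
    have Ei : (Path.Homotopic.Quotient.mk h').trans (Path.Homotopic.Quotient.mk seg) =
        (Path.Homotopic.Quotient.mk a).trans (Path.Homotopic.Quotient.mk dp).symm := by
      rw [← Path.Homotopic.Quotient.mk_trans, ← Path.Homotopic.Quotient.mk_symm,
        ← Path.Homotopic.Quotient.mk_trans]
      refine good i _ _ ?_ ?_
      · rw [Path.trans_range]; exact union_subset hh' hseg
      · rw [Path.trans_range, Path.symm_range]
        exact union_subset (hpth _ _ _ _ _) (hdp.trans inter_subset_left)
    have Ej : Path.Homotopic.Quotient.mk h =
        (Path.Homotopic.Quotient.mk b).symm.trans (Path.Homotopic.Quotient.mk dp).symm := by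
      rw [← Path.Homotopic.Quotient.mk_symm, ← Path.Homotopic.Quotient.mk_symm,
        ← Path.Homotopic.Quotient.mk_trans]
      refine good j _ _ hh ?_
      rw [Path.trans_range, Path.symm_range, Path.symm_range]
      exact union_subset (hpth _ _ _ _ _) (hdp.trans inter_subset_right)
    -- the generator `α (i, j, d')` unfolds
    have hc : (((d' : X) ∈ V i ∧ (d' : X) ∈ V j) ∧ Joined x₀ (v i) ∧ Joined x₀ (v j)) :=
      ⟨hdij, Ji, J⟩
    have hα : α (i, j, d') = FundamentalGroup.fromPath (Path.Homotopic.Quotient.mk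
        ((Ji.somePath.trans (a.trans b)).trans J.somePath.symm)) := dif_pos hc
    -- the prefix up to `s'` is the prefix up to `s` followed by the piece `seg`
    have E3 : Path.Homotopic.Quotient.mk ((γ.subpath 0 s').cast hx rfl) =
        (Path.Homotopic.Quotient.mk ((γ.subpath 0 s).cast hx rfl)).trans
          (Path.Homotopic.Quotient.mk seg) := by
      rw [← Path.Homotopic.Quotient.mk_trans, Path.Homotopic.Quotient.eq]
      exact Path.Homotopic.pathCast
        (Path.Homotopic.symm ⟨Path.Homotopy.subpathTransSubpath γ 0 s s'⟩) hx rfl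
    refine ⟨α (i, j, d') * w₁, H.mul_mem (hαH _) hw₁, ?_⟩
    rw [E3, E1, FundamentalGroup.mul_def, hα, Path.Homotopic.Quotient.trans_assoc,
      Path.Homotopic.Quotient.trans_assoc, Ei, Ej]
    simp only [FundamentalGroup.toPath, FundamentalGroup.toArrow, FundamentalGroup.fromPath,
      FundamentalGroup.fromArrow, Path.Homotopic.Quotient.mk_trans, Path.Homotopic.Quotient.mk_symm,
      Path.Homotopic.Quotient.trans_assoc, cancel, cancel']
  -- (6) induction along the partition and conclusion
  have hall : ∀ n, P (t n) (idx n) := by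
    intro n
    induction n with
    | zero => rw [ht0]; exact base _
    | succ n ih =>
      exact step (t n) (t (n + 1)) (idx n) (idx (n + 1)) (htm n.le_succ) (hidx n) ih
  have hfin : P 1 (idx N) := by rw [← hN N le_rfl]; exact hall N
  have h1i : x₀ ∈ V (idx N) := by
    have : γ (t N) ∈ V (idx N) := hidx N ⟨le_rfl, htm N.le_succ⟩
    rwa [hN N le_rfl, γ.target] at this
  let h : Path (v (idx N)) x₀ := pth (idx N) (v (idx N)) (hv (idx N)) x₀ h1i
  have hh : range h ⊆ V (idx N) := hpth _ _ _ _ _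
  have J : Joined x₀ (v (idx N)) := ⟨h.symm⟩
  obtain ⟨w, hw, E⟩ := hfin x₀ γ.target h1i J h hh
  rw [e01] at E
  have hγ : FundamentalGroup.fromPath (Path.Homotopic.Quotient.mk γ) = β (idx N) * w := by
    rw [FundamentalGroup.mul_def, hβ (idx N) h1i J h hh]
    exact E
  rw [hγ]
  exact H.mul_mem (hβH (idx N)) hw

open UniversalCover in
/-- **Lee, Thm. 7.21: the fundamental group of a second countable, strongly locally contractible
space (e.g. a second countable topological manifold) is countable** — good sets form a neighbourhood
basis (`UniversalCover.exists_mem_goodSets_subset`), Lindelöf extracts a countable good cover, a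
second countable space has a countable dense subset. [cite: Lee2011TopologicalManifolds, Thm. 7.21] -/
theorem countable_fundamentalGroup [SecondCountableTopology X] [StronglyLocallyContractibleSpace X]
    (x₀ : X) : Countable (FundamentalGroup X x₀) := by
  -- a good set around every point
  have hg : ∀ x : X, ∃ U ∈ goodSets X, x ∈ U := fun x => by
    obtain ⟨U, hU, hxU, -⟩ := exists_mem_goodSets_subset x univ_mem
    exact ⟨U, hU, hxU⟩
  choose U hU hxU using hg
  -- Lindelöf: countably many of them cover
  obtain ⟨T, hTc, hT⟩ := isOpen_iUnion_countable U fun x => isOpen_of_mem_goodSets (hU x)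
  haveI : Countable T := hTc.to_subtype
  have hcov : ⋃ i : T, U i = univ := by
    rw [← (biUnion_eq_iUnion T fun x _ => U x), hT, eq_univ_iff_forall]
    exact fun x => mem_iUnion.2 ⟨x, hxU x⟩
  obtain ⟨D, hDc, hDd⟩ := exists_countable_dense X
  exact countable_fundamentalGroup_of_cover hDc hDd (fun i : T => U i) (fun i => hU i) hcov x₀

end Cover

/-! ### Covering spaces with countable fibres over second countable bases -/

section Covering

variable {E X : Type*} [TopologicalSpace E] [TopologicalSpace X] {p : E → X}

/-- **A covering space with countable fibres over a second countable base is second countable**: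
countably many evenly covered open sets cover the base (Lindelöf), and over each the total space is
homeomorphic to `U × (fibre)` (Mathlib's definition of an evenly covered point), a second countable
space.
[cite: Lee2011TopologicalManifolds, Thm. 7.21 (proof, corollary for covering spaces)] -/
theorem secondCountableTopology_of_isCoveringMap [SecondCountableTopology X] (hp : IsCoveringMap p)
    (hfib : ∀ x : X, Countable (p ⁻¹' {x})) : SecondCountableTopology E := by
  classical
  -- an evenly covered open neighbourhood of every point, with its product chart
  have hev : ∀ x : X, ∃ U : Set X, x ∈ U ∧ IsOpen U ∧ Nonempty (p ⁻¹' U ≃ₜ U × (p ⁻¹' {x})) :=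
    fun x => by
      obtain ⟨-, U, hxU, hU, -, H, -⟩ := hp x
      exact ⟨U, hxU, hU, ⟨H⟩⟩
  choose U hxU hUo hH using hev
  obtain ⟨T, hTc, hT⟩ := isOpen_iUnion_countable U hUo
  haveI : Countable T := hTc.to_subtype
  have hcovX : ⋃ i : T, U i = univ := by
    rw [← (biUnion_eq_iUnion T fun x _ => U x), hT, eq_univ_iff_forall]
    exact fun x => mem_iUnion.2 ⟨x, hxU x⟩
  -- the countable open cover of `E` by the preimages, each second countable
  let W : T → Set E := fun i => p ⁻¹' U i
  have hWo : ∀ i, IsOpen (W i) := fun i => (hUo i).preimage hp.continuous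
  have hWcov : ⋃ i, W i = univ := by
    simp only [W, ← preimage_iUnion, hcovX, preimage_univ]
  haveI : ∀ i, SecondCountableTopology (W i) := by
    intro i
    haveI : DiscreteTopology (p ⁻¹' {(i : X)}) := (hp i).1
    haveI : Countable (p ⁻¹' {(i : X)}) := hfib i
    let φ : W i ≃ₜ U i × (p ⁻¹' {(i : X)}) := (hH i).some
    exact φ.secondCountableTopology
  exact secondCountableTopology_of_countable_cover hWo hWcov

end Covering

/-! ### The universal cover -/

namespace UniversalCover

variable {X : Type u} [TopologicalSpace X] {x₀ : X}

/-- The fibre of the universal cover over `x` is the orbit of any of its points under the deck action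
of `π₁(X, x₀)` (`proj_eq_iff_mem_orbit`), hence countable when `π₁(X, x₀)` is.
[cite: HatcherAT2002, §1.3 Prop. 1.39] -/
theorem countable_fibre [SecondCountableTopology X] [PathConnectedSpace X]
    [StronglyLocallyContractibleSpace X] (x : X) :
    Countable (proj ⁻¹' ({x} : Set X) : Set (UniversalCover X x₀)) := by
  haveI := countable_fundamentalGroup (X := X) x₀
  obtain ⟨a, ha⟩ := proj_surjective (X := X) (x₀ := x₀) x
  have hsub : proj ⁻¹' ({x} : Set X) ⊆ range fun α : FundamentalGroup X x₀ => α • a := by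
    intro b hb
    have hb' : proj b = proj a := by rw [mem_preimage, mem_singleton_iff] at hb; rw [hb, ha]
    obtain ⟨α, hα⟩ := MulAction.mem_orbit_iff.1 (proj_eq_iff_mem_orbit.1 hb')
    exact ⟨α, hα⟩
  exact ((countable_range _).mono hsub).to_subtype

/-- **The universal cover of a second countable space is second countable** (path connected,
strongly locally contractible base — e.g. a connected second countable manifold): countable fibres
(`≅ π₁(X, x₀)`, Lee Thm. 7.21) over a second countable base.
[cite: Lee2011TopologicalManifolds, Thm. 7.21] -/
theorem secondCountableTopology [SecondCountableTopology X] [PathConnectedSpace X]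
    [StronglyLocallyContractibleSpace X] : SecondCountableTopology (UniversalCover X x₀) :=
  secondCountableTopology_of_isCoveringMap isCoveringMap_proj countable_fibre

end UniversalCover

end Literature.Topology.CoveringSpaces

end
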